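import Literature.ModelTheory.ExponentialFields.ExpPolyJacobian
import Mathlib.RingTheory.AlgebraicIndependent.Basic
import Mathlib.FieldTheory.IntermediateField.Adjoin.Basic
import Mathlib.Analysis.SpecialFunctions.Exp
import HarnessLib

/-!
# The ideal of the point `(ā, e^{ā})`: Jones–Servi's Proposition 3.8 (named fact)

Family `periods` (periods.S27), topic `Literature/ModelTheory/ExponentialFields`: leaf (B3) of the
decomposition of the conditional half of Macintyre–Wilkie's theorem
(`Literature.ModelTheory.ExponentialFields.macintyreWilkie_existential_of_schanuelProperty`; assembly in
`MacintyreWilkieConditionalHalf.lean`).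

Jones–Servi 2011 (transposing Macintyre–Wilkie 1996, §5), proof of Thm. 3.11: "by SC the
transcendence degree is exactly `n` … Let `P := {q ∈ ℤ[α][ȳ, z̄] : q(ã) = 0}`. Then `P` is a
prime ideal and hence by Proposition 3.8, there exists `p₀ ∈ ℤ[α][ȳ, z̄] ∖ P` such that the
ideal `p₀P` is generated by `n` polynomials `p₁, …, pₙ` … since `g̃ ∈ P`, there are `b₁, …, bₙ`
such that `p₀ · g̃ = Σ bⱼ pⱼ`."  This file vendors **Proposition 3.8 at the point `(ā, e^{ā})`**
as a named fact (`JonesServi2011_pointIdealGenerators`) and proves the bookkeeping used by the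
assembly (`exists_identities_of_pointIdealGenerators`: one `p₀ = q₀ᴷ` for finitely many members
of the ideal).  The commutative algebra behind Prop. 3.8 (regular local rings of polynomial
rings, the dimension formula) is in Mathlib and in `Literature/RingTheory/KrullDimension`; the
discharge of the named fact is left to a companion file.

## References

* G. O. Jones, T. Servi, *On the decidability of the real field with a generic power function*,
  J. Symb. Log. 76 (2011), Prop. 3.8, Thm. 3.11 (proof).
* A. Macintyre, A. J. Wilkie, *On the decidability of the real exponential field* (1996), §5.
-/

noncomputable section

open scoped BigOperators
open MvPolynomial

namespace Literature.ModelTheory.ExponentialFields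

open ExpPoly

/-! ### (B3) The ideal of the point `(ā, e^{ā})` (Jones–Servi 2011, Prop. 3.8) -/

/-- **Jones–Servi 2011, Proposition 3.8** ("an easy consequence of the Noether normalization
lemma"): *Let `R` be a domain, `m ∈ ℕ`, `Q ⊆ R[x₁, …, x_m]` a prime ideal with `Q ∩ R = {0}` and
`r = trdeg_R Frac(R[x₁, …, x_m]/Q)`. Then there exists `q₀ ∈ R[x₁, …, x_m] ∖ Q` such that the
ideal `q₀Q` is generated by `m − r` polynomials* — read, as in its use in the proof of Thm. 3.11
(p. 12: "`p₀ g̃ = Σⱼ bⱼ pⱼ`"), as: every `q ∈ Q` satisfies `q₀ᵏ q ∈ (p₁, …, p_{m−r})` for some `k`.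
Vendored in the special case used for `exp`: `R = ℤ`, `m = 2N`, `Q` = the ideal of all
`q ∈ ℤ[x̄, ȳ]` vanishing at the point `(ā, e^{ā}) ∈ ℝ^{2N}` (prime, `Q ∩ ℤ = {0}`,
`Frac(ℤ[x̄, ȳ]/Q) ≅ ℚ(ā, e^{ā})`, so `r = trdeg_ℚ ℚ(ā, e^{ā})`), and weakened monotonically to any
number `s ≥ m − r` of generators (pad with zeros).  A named fact (`def … : Prop`), not yet proved
here. [cite: JonesServi2011, Prop. 3.8 (case R = ℤ, Q = ideal of (ā, e^ā))] -/
def JonesServi2011_pointIdealGenerators : Prop :=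
  ∀ (N s : ℕ) (a : Fin N → ℝ),
    ((N + N : ℕ) : Cardinal) ≤ (s : Cardinal) +
        Algebra.trdeg ℚ ↥(IntermediateField.adjoin ℚ (Set.range a ∪ Set.range (Real.exp ∘ a))) →
      ∃ (q₀ : MvPolynomial (Fin N ⊕ Fin N) ℤ) (M : Fin s → MvPolynomial (Fin N ⊕ Fin N) ℤ),
        expEval q₀ a ≠ 0 ∧ (∀ l, expEval (M l) a = 0) ∧
          ∀ q : MvPolynomial (Fin N ⊕ Fin N) ℤ, expEval q a = 0 →
            ∃ (k : ℕ) (b : Fin s → MvPolynomial (Fin N ⊕ Fin N) ℤ), q₀ ^ k * q = ∑ l, b l * M l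

/-- **Uniformising the powers of `q₀`** over finitely many members of the ideal: from (B3) at a
point where SC gives `N ≤ trdeg`, a single `p₀ = q₀ᴷ` with `p₀ · P ∈ (M)` and `p₀ · fᵢ ∈ (M)` for
all `i`, `M` square. [folklore] -/
theorem exists_identities_of_pointIdealGenerators (hB3 : JonesServi2011_pointIdealGenerators)
    {N : ℕ} {a : Fin N → ℝ}
    (hSC : (N : Cardinal) ≤
      Algebra.trdeg ℚ ↥(IntermediateField.adjoin ℚ (Set.range a ∪ Set.range (Real.exp ∘ a))))
    (f : Fin N → MvPolynomial (Fin N ⊕ Fin N) ℤ) (P : MvPolynomial (Fin N ⊕ Fin N) ℤ)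
    (hf : ∀ i, expEval (f i) a = 0) (hP : expEval P a = 0) :
    ∃ (M : Fin N → MvPolynomial (Fin N ⊕ Fin N) ℤ) (p₀ : MvPolynomial (Fin N ⊕ Fin N) ℤ)
      (b : Fin N → MvPolynomial (Fin N ⊕ Fin N) ℤ) (c : Fin N → Fin N → MvPolynomial (Fin N ⊕ Fin N) ℤ),
      (∀ l, expEval (M l) a = 0) ∧ expEval p₀ a ≠ 0 ∧ p₀ * P = ∑ l, b l * M l ∧
        ∀ i, p₀ * f i = ∑ l, c i l * M l := by
  have hcard : ((N + N : ℕ) : Cardinal) ≤ (N : Cardinal) +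
      Algebra.trdeg ℚ ↥(IntermediateField.adjoin ℚ (Set.range a ∪ Set.range (Real.exp ∘ a))) := by
    rw [Nat.cast_add]
    exact add_le_add le_rfl hSC
  obtain ⟨q₀, M, hq₀, hM, hgen⟩ := hB3 N N a hcard
  choose kP bP hbP using hgen P hP
  choose k c hc using fun i => hgen (f i) (hf i)
  -- a common exponent
  set K : ℕ := kP + ∑ i, k i with hK
  have hkP : kP ≤ K := by rw [hK]; exact Nat.le_add_right _ _
  have hki : ∀ i, k i ≤ K := fun i => by
    rw [hK]
    exact (Finset.single_le_sum (f := k) (fun _ _ => Nat.zero_le _) (Finset.mem_univ i)).trans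
      (Nat.le_add_left _ _)
  refine ⟨M, q₀ ^ K, fun l => q₀ ^ (K - kP) * bP l, fun i l => q₀ ^ (K - k i) * c i l, hM, ?_, ?_, ?_⟩
  · rw [expEval, map_pow]
    exact pow_ne_zero _ hq₀
  · calc q₀ ^ K * P = q₀ ^ (K - kP) * (q₀ ^ kP * P) := by
          rw [← mul_assoc, ← pow_add, Nat.sub_add_cancel hkP]
      _ = ∑ l, q₀ ^ (K - kP) * bP l * M l := by
          rw [hbP, Finset.mul_sum]
          exact Finset.sum_congr rfl fun l _ => by ring
  · intro i
    calc q₀ ^ K * f i = q₀ ^ (K - k i) * (q₀ ^ k i * f i) := by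
          rw [← mul_assoc, ← pow_add, Nat.sub_add_cancel (hki i)]
      _ = ∑ l, q₀ ^ (K - k i) * c i l * M l := by
          rw [hc i, Finset.mul_sum]
          exact Finset.sum_congr rfl fun l _ => by ring

end Literature.ModelTheory.ExponentialFields

end
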